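import Mathlib
import HarnessLib
import Summits.HubbardSuperconductivity.HubbardSuperconductivity.Theorems.KLProgrammeC4aCausticPairLayer

/-!
# Route `KLProgramme` — crux C4a, S3 brick (B4) «(B4)-UMK1», (N3) in DERIVATIVE-FREE form: the PRODUCT-FORM FLOOR `b|ϑ − c₁||ϑ − c₂| ≤ |δ₀(ϑ)|` of the caustic pair
# layer from STRONG CONVEXITY — partial minimisation preserves strong convexity (no implicit function), two zeros give the product floor, a zero that is a minimum
# gives the square floor

Cell `gate-hubbard-kl`, seat hubbard-kl-k3c3-p3 (g28; row «implicit-function / monotonicity route for μ(n)»).  Located brick for the (C)-closer lane hubbard-kl-c4a-1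
(stub (C) `stub_twoLeg_curvature` of `KLRegimeEngineV17F2`, stmt-HubbardSuperconductivity-20437), memo HOME/hubbard-kl-k3c3-p3/U1-CAUSTIC-SUP.md §3 (the Hessian of
`g(ϑ,φ) = e_K(k + q′(ϑ) − 2πm − p(φ))` at an antipodal-umklapp configuration is POSITIVE DEFINITE, `det = κ²Q_p² + 2λQ_pQ′`) and §4 (N3).  The `hm` hypothesis of
`…C4aCausticPairLayer(Remainder)` asks `b|ϑ − c₁||ϑ − c₂| ≤ |δ₀(ϑ)|` for the caustic offset `δ₀(ϑ) = min_φ g(ϑ,φ)`.  This file supplies it from convexity alone: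
* §1 **`convexOn_partialMin_sub_sq`**: if `(ϑ,φ) ↦ g ϑ φ − (κ/2)ϑ²` is (jointly) convex on `I ×ˢ W` (`W` convex) and `φ*(ϑ) ∈ W` minimises `g ϑ ·` on `W` for `ϑ ∈ I`, then
  `ϑ ↦ g ϑ (φ* ϑ) − (κ/2)ϑ²` is convex on `I` — the minimum inherits the strong-convexity modulus in the parameter (partial minimisation; no derivative of `φ*`);
* §2 **`mul_mul_le_abs_of_convexOn_two_zeros`**: `m − (κ/2)(·)²` convex on `I`, `m c₁ = m c₂ = 0`, `c₁ < c₂` in `I` ⟹ `(κ/2)|ϑ − c₁||ϑ − c₂| ≤ |m ϑ|` on `I`, with the SIGNS: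
  `m ≤ −(κ/2)(ϑ−c₁)(c₂−ϑ)` inside (post-caustic window), `(κ/2)(ϑ−c₁)(ϑ−c₂) ≤ m` outside (pre-caustic) — a weakly transversal pair;
* §3 **`sq_le_of_convexOn_zero_min`**: `m − (κ/2)(·)²` convex on `I`, `0 < κ`, `m c = 0`, `0 ≤ m` on `I` ⟹ `(κ/2)(ϑ − c)² ≤ m ϑ` on `I` — the PRE-SIDE DOUBLE ZERO (touch) floor.
Pure convex analysis; nothing about the model; nothing asserts (C), K3 or superconductivity.  (The joint strong convexity of the actual partner band near the touch —
a curvature-floor computation on landed second jets — is the remaining model-side input.)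
References: Salmhofer 1999 §4.5.3 [cite: Salmhofer1999]; FST II CPAM 51 (1998) §3 [cite: FeldmanSalmhoferTrubowitz1998].
-/

noncomputable section

namespace Summit.HubbardSuperconductivity.HubbardSuperconductivity.Theorems.C4a

set_option linter.dupNamespace false -- summit = problem name (single-conjunct summit), D-0017

open Real Set

/-! ## §1 Partial minimisation preserves strong convexity -/

/-- **THE MINIMUM INHERITS THE STRONG-CONVEXITY MODULUS** (partial minimisation; no implicit function).  `g : ℝ → ℝ → ℝ`; `(ϑ,φ) ↦ g ϑ φ − (κ/2)ϑ²` convex on `I ×ˢ W`;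
`W` convex; for `ϑ ∈ I` a minimiser `φ*(ϑ) ∈ W` of `g ϑ ·` over `W`.  THEN `ϑ ↦ g ϑ (φ* ϑ) − (κ/2)ϑ²` is convex on `I`. -/
theorem convexOn_partialMin_sub_sq {g : ℝ → ℝ → ℝ} {vs : ℝ → ℝ} {I W : Set ℝ} {κ : ℝ}
    (hg : ConvexOn ℝ (I ×ˢ W) (fun p : ℝ × ℝ => g p.1 p.2 - κ / 2 * p.1 ^ 2)) (hI : Convex ℝ I) (hW : Convex ℝ W)
    (hvs : ∀ ϑ ∈ I, vs ϑ ∈ W) (hmin : ∀ ϑ ∈ I, ∀ φ ∈ W, g ϑ (vs ϑ) ≤ g ϑ φ) :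
    ConvexOn ℝ I (fun ϑ => g ϑ (vs ϑ) - κ / 2 * ϑ ^ 2) := by
  refine ⟨hI, fun x hx y hy a b ha hb hab => ?_⟩
  -- the convex combination of the two minimising points lies in `I ×ˢ W`
  have hxW := hvs x hx
  have hyW := hvs y hy
  have hφ : a * vs x + b * vs y ∈ W := by
    have := hW hxW hyW ha hb hab
    simpa [smul_eq_mul] using this
  have hϑ : a * x + b * y ∈ I := by
    have := hI hx hy ha hb hab
    simpa [smul_eq_mul] using this
  -- joint convexity at the points `(x, φ* x)`, `(y, φ* y)`
  have hj := hg.2 (mk_mem_prod hx hxW) (mk_mem_prod hy hyW) ha hb hab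
  simp only [Prod.smul_mk, Prod.mk_add_mk, smul_eq_mul] at hj
  -- minimality at the combined parameter
  have hm := hmin (a * x + b * y) hϑ (a * vs x + b * vs y) hφ
  simp only [smul_eq_mul]
  linarith

/-! ## §2 Two zeros: the product-form floor with signs -/

/-- **TWO ZEROS OF A STRONGLY CONVEX FUNCTION GIVE THE PRODUCT FLOOR.**  `ϑ ↦ m ϑ − (κ/2)ϑ²` convex on `I` (any real `κ`), `c₁ < c₂` in `I`, `m c₁ = m c₂ = 0`.  THEN
(i) inside: `m ϑ ≤ −(κ/2)(ϑ − c₁)(c₂ − ϑ)` for `ϑ ∈ [c₁, c₂]`; (ii) right: `(κ/2)(ϑ − c₁)(ϑ − c₂) ≤ m ϑ` for `ϑ ∈ I`, `c₂ ≤ ϑ`; (iii) left: the same for `ϑ ≤ c₁`;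
hence `(κ/2)·|ϑ − c₁|·|ϑ − c₂| ≤ |m ϑ|` on `I` — the `hm` hypothesis of `…C4aCausticPairLayer.intervalIntegral_caustic_pair_le` with `b = κ/2`. -/
theorem mul_mul_le_abs_of_convexOn_two_zeros {m : ℝ → ℝ} {I : Set ℝ} {κ c₁ c₂ : ℝ}
    (hφ : ConvexOn ℝ I (fun ϑ => m ϑ - κ / 2 * ϑ ^ 2)) (hc₁ : c₁ ∈ I) (hc₂ : c₂ ∈ I) (hlt : c₁ < c₂)
    (h₁ : m c₁ = 0) (h₂ : m c₂ = 0) {ϑ : ℝ} (hϑ : ϑ ∈ I) :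
    κ / 2 * |ϑ - c₁| * |ϑ - c₂| ≤ |m ϑ| := by
  set φ : ℝ → ℝ := fun ϑ => m ϑ - κ / 2 * ϑ ^ 2 with hφdef
  have hφ₁ : φ c₁ = -(κ / 2) * c₁ ^ 2 := by simp only [hφdef, h₁]; ring
  have hφ₂ : φ c₂ = -(κ / 2) * c₂ ^ 2 := by simp only [hφdef, h₂]; ring
  have hmφ : m ϑ = φ ϑ + κ / 2 * ϑ ^ 2 := by simp only [hφdef]; ring
  have hne12 : c₂ - c₁ ≠ 0 := ne_of_gt (sub_pos.2 hlt)
  rcases lt_trichotomy ϑ c₁ with hl | he | hr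
  · -- left of `c₁`: `c₁` is a convex combination of `ϑ` and `c₂`
    have hd : 0 < c₂ - ϑ := by linarith
    set a : ℝ := (c₂ - c₁) / (c₂ - ϑ) with ha
    set b : ℝ := (c₁ - ϑ) / (c₂ - ϑ) with hb
    have ha0 : 0 ≤ a := by rw [ha]; exact div_nonneg (by linarith) hd.le
    have hb0 : 0 ≤ b := by rw [hb]; exact div_nonneg (by linarith) hd.le
    have hab : a + b = 1 := by rw [ha, hb]; field_simp; ring
    have hcomb : a * ϑ + b * c₂ = c₁ := by rw [ha, hb]; field_simp; ring
    have hj := hφ.2 hϑ hc₂ ha0 hb0 hab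
    simp only [smul_eq_mul, hcomb] at hj
    -- `φ c₁ ≤ a φ ϑ + b φ c₂` ⇒ lower bound on `φ ϑ`
    have hapos : 0 < a := by rw [ha]; exact div_pos (by linarith) hd
    have key : κ / 2 * (ϑ - c₁) * (ϑ - c₂) ≤ m ϑ := by
      rw [hmφ]
      -- multiply through by `a (c₂ − ϑ) = c₂ − c₁ > 0`
      have h3 : a * φ ϑ ≥ φ c₁ - b * φ c₂ := by linarith
      rw [hφ₁, hφ₂] at h3
      have h4 : φ ϑ ≥ (-(κ / 2) * c₁ ^ 2 - b * (-(κ / 2) * c₂ ^ 2)) / a := by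
        rw [ge_iff_le, div_le_iff₀ hapos]; linarith
      have hne : c₂ - ϑ ≠ 0 := hd.ne'
      have h5 : (-(κ / 2) * c₁ ^ 2 - b * (-(κ / 2) * c₂ ^ 2)) / a = κ / 2 * (ϑ - c₁) * (ϑ - c₂) - κ / 2 * ϑ ^ 2 := by
        rw [ha, hb]; field_simp; ring
      linarith [h4, h5]
    rw [abs_of_neg (by linarith : ϑ - c₁ < 0), abs_of_neg (by linarith : ϑ - c₂ < 0)]
    calc κ / 2 * -(ϑ - c₁) * -(ϑ - c₂) = κ / 2 * (ϑ - c₁) * (ϑ - c₂) := by ring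
      _ ≤ m ϑ := key
      _ ≤ |m ϑ| := le_abs_self _
  · -- at `c₁`
    subst he
    simp [h₁]
  rcases le_or_gt ϑ c₂ with hin | hout
  · -- inside `[c₁, c₂]`: `ϑ` is a convex combination of `c₁` and `c₂`
    have hd : 0 < c₂ - c₁ := by linarith
    set a : ℝ := (c₂ - ϑ) / (c₂ - c₁) with ha
    set b : ℝ := (ϑ - c₁) / (c₂ - c₁) with hb
    have ha0 : 0 ≤ a := by rw [ha]; exact div_nonneg (by linarith) hd.le
    have hb0 : 0 ≤ b := by rw [hb]; exact div_nonneg (by linarith) hd.le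
    have hab : a + b = 1 := by rw [ha, hb]; field_simp; ring
    have hcomb : a * c₁ + b * c₂ = ϑ := by rw [ha, hb]; field_simp; ring
    have hj := hφ.2 hc₁ hc₂ ha0 hb0 hab
    simp only [smul_eq_mul, hcomb, hφ₁, hφ₂] at hj
    have key : m ϑ ≤ -(κ / 2 * (ϑ - c₁) * (c₂ - ϑ)) := by
      rw [hmφ]
      have h5 : a * (-(κ / 2) * c₁ ^ 2) + b * (-(κ / 2) * c₂ ^ 2) + κ / 2 * ϑ ^ 2 = -(κ / 2 * (ϑ - c₁) * (c₂ - ϑ)) := by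
        rw [ha, hb]; field_simp; ring
      linarith [hj, h5]
    rw [abs_of_nonneg (by linarith : 0 ≤ ϑ - c₁), abs_of_nonpos (by linarith : ϑ - c₂ ≤ 0)]
    calc κ / 2 * (ϑ - c₁) * -(ϑ - c₂) = κ / 2 * (ϑ - c₁) * (c₂ - ϑ) := by ring
      _ ≤ -m ϑ := by linarith [key]
      _ ≤ |m ϑ| := neg_le_abs _
  · -- right of `c₂`: `c₂` is a convex combination of `c₁` and `ϑ`
    have hd : 0 < ϑ - c₁ := by linarith
    set a : ℝ := (ϑ - c₂) / (ϑ - c₁) with ha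
    set b : ℝ := (c₂ - c₁) / (ϑ - c₁) with hb
    have ha0 : 0 ≤ a := by rw [ha]; exact div_nonneg (by linarith) hd.le
    have hb0 : 0 ≤ b := by rw [hb]; exact div_nonneg (by linarith) hd.le
    have hab : a + b = 1 := by rw [ha, hb]; field_simp; ring
    have hcomb : a * c₁ + b * ϑ = c₂ := by rw [ha, hb]; field_simp; ring
    have hj := hφ.2 hc₁ hϑ ha0 hb0 hab
    simp only [smul_eq_mul, hcomb] at hj
    have hbpos : 0 < b := by rw [hb]; exact div_pos (by linarith) hd
    have key : κ / 2 * (ϑ - c₁) * (ϑ - c₂) ≤ m ϑ := by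
      rw [hmφ]
      have h3 : b * φ ϑ ≥ φ c₂ - a * φ c₁ := by linarith
      rw [hφ₁, hφ₂] at h3
      have h4 : φ ϑ ≥ (-(κ / 2) * c₂ ^ 2 - a * (-(κ / 2) * c₁ ^ 2)) / b := by
        rw [ge_iff_le, div_le_iff₀ hbpos]; linarith
      have hne : ϑ - c₁ ≠ 0 := hd.ne'
      have h5 : (-(κ / 2) * c₂ ^ 2 - a * (-(κ / 2) * c₁ ^ 2)) / b = κ / 2 * (ϑ - c₁) * (ϑ - c₂) - κ / 2 * ϑ ^ 2 := by
        rw [ha, hb]; field_simp; ring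
      linarith [h4, h5]
    rw [abs_of_pos hd, abs_of_pos (by linarith : 0 < ϑ - c₂)]
    exact key.trans (le_abs_self _)

/-! ## §3 A zero that is a minimum: the square floor (pre-side touch) -/

/-- **A ZERO OF A NONNEGATIVE STRONGLY CONVEX FUNCTION IS A QUADRATIC TOUCH.**  `ϑ ↦ m ϑ − (κ/2)ϑ²` convex on `I`, `0 < κ`, `c ∈ I`, `m c = 0`, `0 ≤ m` on `I`.  THEN
`(κ/2)(ϑ − c)² ≤ m ϑ` for `ϑ ∈ I` — the pre-side double zero of the caustic offset at an antipodal-umklapp touch (`hm` of the pair layer with `c₁ = c₂ = c`, `b = κ/2`). -/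
theorem sq_le_of_convexOn_zero_min {m : ℝ → ℝ} {I : Set ℝ} {κ c : ℝ}
    (hφ : ConvexOn ℝ I (fun ϑ => m ϑ - κ / 2 * ϑ ^ 2)) (hκ : 0 < κ) (hc : c ∈ I) (h0 : m c = 0) (hpos : ∀ ϑ ∈ I, 0 ≤ m ϑ)
    {ϑ : ℝ} (hϑ : ϑ ∈ I) : κ / 2 * (ϑ - c) ^ 2 ≤ m ϑ := by
  by_contra hlt
  push Not at hlt
  -- `ψ u := m u − (κ/2)(u − c)²` is `φ` plus an affine function; `ψ c = 0`, `ψ ϑ < 0`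
  have hne : ϑ ≠ c := by
    rintro rfl
    simp [h0] at hlt
  have hd : 0 < (ϑ - c) ^ 2 := by positivity
  set s : ℝ := m ϑ - κ / 2 * (ϑ - c) ^ 2 with hs
  have hsneg : s < 0 := by rw [hs]; linarith
  -- choose `λ ∈ (0, 1]` with `(κ/2) λ (ϑ − c)² ≤ −s/2`
  set lam : ℝ := min 1 (-s / (κ * (ϑ - c) ^ 2)) with hlam
  have hlam_pos : 0 < lam := by
    rw [hlam]; refine lt_min zero_lt_one (div_pos (by linarith) (by positivity))
  have hlam_le1 : lam ≤ 1 := min_le_left _ _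
  have hlam_le : lam ≤ -s / (κ * (ϑ - c) ^ 2) := min_le_right _ _
  have hlam_bd : κ / 2 * lam * (ϑ - c) ^ 2 ≤ -s / 2 := by
    have h1 : lam * (κ * (ϑ - c) ^ 2) ≤ -s := by
      have := mul_le_mul_of_nonneg_right hlam_le (by positivity : 0 ≤ κ * (ϑ - c) ^ 2)
      rwa [div_mul_cancel₀ _ (by positivity : κ * (ϑ - c) ^ 2 ≠ 0)] at this
    nlinarith [h1]
  -- the point `u = c + λ(ϑ − c)` is in `I` and `m u < 0`
  set u : ℝ := (1 - lam) * c + lam * ϑ with hu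
  have huI : u ∈ I := by
    have := hφ.1 hc hϑ (by linarith : 0 ≤ 1 - lam) hlam_pos.le (by ring)
    simpa [smul_eq_mul, hu] using this
  have hj := hφ.2 hc hϑ (by linarith : 0 ≤ 1 - lam) hlam_pos.le (by ring)
  simp only [smul_eq_mul, h0] at hj
  -- `φ u ≤ (1−λ)φ c + λ φ ϑ` rewritten for `m`
  have hmu : m u ≤ lam * s + κ / 2 * lam ^ 2 * (ϑ - c) ^ 2 := by
    have h5 : (1 - lam) * (0 - κ / 2 * c ^ 2) + lam * (m ϑ - κ / 2 * ϑ ^ 2) + κ / 2 * ((1 - lam) * c + lam * ϑ) ^ 2 =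
        lam * s + κ / 2 * lam ^ 2 * (ϑ - c) ^ 2 - κ / 2 * lam * (1 - lam) * 0 := by rw [hs]; ring
    have h6 : m u = (m u - κ / 2 * u ^ 2) + κ / 2 * u ^ 2 := by ring
    rw [h6, hu]
    nlinarith [hj, h5]
  have hneg : m u < 0 := by
    have h7 : κ / 2 * lam ^ 2 * (ϑ - c) ^ 2 = lam * (κ / 2 * lam * (ϑ - c) ^ 2) := by ring
    rw [h7] at hmu
    have h8 : lam * s + lam * (κ / 2 * lam * (ϑ - c) ^ 2) ≤ lam * s + lam * (-s / 2) := by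
      have := mul_le_mul_of_nonneg_left hlam_bd hlam_pos.le
      linarith
    have h9 : lam * s + lam * (-s / 2) = lam * (s / 2) := by ring
    have h10 : lam * (s / 2) < 0 := mul_neg_of_pos_of_neg hlam_pos (by linarith)
    linarith
  exact absurd (hpos u huI) (not_le.2 hneg)

/-! ## §4 (appended, g28) Joint strong convexity from second derivatives along segments -/

/-- `iteratedDeriv 2` of the parabola `s ↦ (κ/2)(u + s·c)²` is the constant `κ·c²`. -/
theorem iteratedDeriv_two_parabola (κ u c s : ℝ) : iteratedDeriv 2 (fun s : ℝ => κ / 2 * (u + s * c) ^ 2) s = κ * c ^ 2 := by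
  have h1 : deriv (fun s : ℝ => κ / 2 * (u + s * c) ^ 2) = fun s => κ * c * (u + s * c) := by
    funext x
    have hl : HasDerivAt (fun s : ℝ => u + s * c) c x := by
      simpa using ((hasDerivAt_id x).mul_const c).const_add u
    have h := ((hasDerivAt_pow 2 (u + x * c)).comp x hl).const_mul (κ / 2)
    have h' : HasDerivAt (fun s : ℝ => κ / 2 * (u + s * c) ^ 2) (κ / 2 * (((2 : ℕ) : ℝ) * (u + x * c) ^ (2 - 1) * c)) x := by
      simpa [Function.comp_def] using h
    rw [h'.deriv]; push_cast; ring
  have h2 : deriv (fun s : ℝ => κ * c * (u + s * c)) = fun _ => κ * c ^ 2 := by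
    funext x
    have hl : HasDerivAt (fun s : ℝ => u + s * c) c x := by
      simpa using ((hasDerivAt_id x).mul_const c).const_add u
    rw [(hl.const_mul (κ * c)).deriv]; ring
  rw [iteratedDeriv_succ, iteratedDeriv_one, h1, h2]

/-- **JOINT STRONG CONVEXITY FROM SEGMENTS**: on a convex `S ⊆ ℝ × ℝ`, if along every segment `s ↦ p + s(q − p)` (`p, q ∈ S`) the function `f` is `C²` with
`κ·(q₁ − p₁)² ≤ ∂ₛ² f(p + s(q − p))` on `[0,1]`, then `p ↦ f p − (κ/2)p₁²` is convex on `S` — the hypothesis of `convexOn_partialMin_sub_sq` from a directional Hessian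
floor (the model-side input (M2) of memo §7 is exactly this floor for the partner-band family near an antipodal-umklapp configuration). -/
theorem convexOn_sub_sq_of_line_deriv2 {f : ℝ × ℝ → ℝ} {S : Set (ℝ × ℝ)} {κ : ℝ} (hS : Convex ℝ S)
    (hline : ∀ p ∈ S, ∀ q ∈ S, ContDiff ℝ 2 (fun s : ℝ => f (p + s • (q - p))) ∧
      ∀ s ∈ Icc (0 : ℝ) 1, κ * (q.1 - p.1) ^ 2 ≤ iteratedDeriv 2 (fun s : ℝ => f (p + s • (q - p))) s) :
    ConvexOn ℝ S (fun p : ℝ × ℝ => f p - κ / 2 * p.1 ^ 2) := by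
  refine ⟨hS, fun p hp q hq a b ha hb hab => ?_⟩
  obtain ⟨hC, hfloor⟩ := hline p hp q hq
  -- the segment function minus the parabola
  set ψ : ℝ → ℝ := fun s => f (p + s • (q - p)) - κ / 2 * (p.1 + s * (q.1 - p.1)) ^ 2 with hψ
  have hpoly : ContDiff ℝ 2 (fun s : ℝ => κ / 2 * (p.1 + s * (q.1 - p.1)) ^ 2) := by
    have : ContDiff ℝ 2 (fun s : ℝ => p.1 + s * (q.1 - p.1)) := (contDiff_const.add (contDiff_id.mul contDiff_const))
    exact contDiff_const.mul (this.pow 2)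
  have hψC : ContDiff ℝ 2 ψ := hC.sub hpoly
  have hψ2 : ∀ s : ℝ, iteratedDeriv 2 ψ s = iteratedDeriv 2 (fun s : ℝ => f (p + s • (q - p))) s - κ * (q.1 - p.1) ^ 2 := fun s => by
    have h := iteratedDeriv_fun_sub (n := 2) (x := s) (hC.contDiffAt.of_le le_rfl) (hpoly.contDiffAt.of_le le_rfl)
    simp only [hψ]
    rw [h, iteratedDeriv_two_parabola]
  -- convexity of `ψ` on `[0,1]` by the second-derivative criterion
  have hψconv : ConvexOn ℝ (Icc (0 : ℝ) 1) ψ := by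
    refine convexOn_of_deriv2_nonneg (convex_Icc 0 1) hψC.continuous.continuousOn
      ((hψC.differentiable two_ne_zero).differentiableOn) ?_ fun x hx => ?_
    · have hd : Differentiable ℝ (iteratedDeriv 1 ψ) := ContDiff.differentiable_iteratedDeriv 1 hψC (by norm_num)
      rw [iteratedDeriv_one] at hd
      exact hd.differentiableOn
    · rw [interior_Icc] at hx
      have e : deriv^[2] ψ x = iteratedDeriv 2 ψ x := by rw [iteratedDeriv_eq_iterate]
      rw [e, hψ2]
      linarith [hfloor x (Ioo_subset_Icc_self hx)]
  -- evaluate the convexity inequality of `ψ` at `s = b = a·0 + b·1`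
  have hj := hψconv.2 (left_mem_Icc.2 zero_le_one) (right_mem_Icc.2 zero_le_one) ha hb hab
  simp only [smul_eq_mul, mul_zero, mul_one, zero_add] at hj
  have hb' : b = 1 - a := by linarith
  have hpt : a • p + b • q = p + b • (q - p) := by
    ext <;> simp [hb', smul_eq_mul] <;> ring
  have hψ0 : ψ 0 = f p - κ / 2 * p.1 ^ 2 := by simp [hψ]
  have hψ1 : ψ 1 = f q - κ / 2 * q.1 ^ 2 := by
    simp only [hψ, one_smul, one_mul, add_sub_cancel]
  have hψb : ψ b = f (a • p + b • q) - κ / 2 * (a • p + b • q).1 ^ 2 := by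
    simp only [hψ, hpt, Prod.fst_add, Prod.smul_fst, Prod.fst_sub, smul_eq_mul]
  show f (a • p + b • q) - κ / 2 * (a • p + b • q).1 ^ 2 ≤ a • (f p - κ / 2 * p.1 ^ 2) + b • (f q - κ / 2 * q.1 ^ 2)
  rw [← hψb, smul_eq_mul, smul_eq_mul, ← hψ0, ← hψ1]
  exact hj

end Summit.HubbardSuperconductivity.HubbardSuperconductivity.Theorems.C4a

end
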